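import Literature.Probability.RandomPlanarGeometry.HexSAWBrickWallStripFugacityWidthOneContactRayContraction
import Literature.Probability.RandomPlanarGeometry.HexSAWBrickWallStripFugacityWidthOneContactSusceptibility
import Literature.Probability.RandomPlanarGeometry.HexSAWBrickWallStripFugacityWidthOneContactBoundaryLimit
import HarnessLib

/-!
# The large deviations of the contact IMBALANCE `(bc − tc)/N`: anti-ray tilts

Child module of `…ContactRayContraction` (change of base / Pythagoras for fibres), `…ContactSusceptibility` (the susceptibility matrix `M⁻¹`)
and `…ContactBoundaryLimit` (the LDP limit on open sets with closure in the closed triangle `T̄`).  The natural tilts for the DIFFERENCE of the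
two contact densities are the ANTI-RAYS `u ↦ (yu, z/u)` (weight `u^{bc − tc}`):
* §1 `antiRay` Pythagoras: if `b(Y,Z) − b(Z,Y) = b(yu,z/u) − b(z/u,yu)` then `J(y,z;Y,Z) = J(y,z;yu,z/u) + J(yu,z/u;Y,Z)`; hence
  ★★★ the joint rate is minimised over the fibre `{b − b' = const}` EXACTLY at the anti-ray point, with minimum `I_anti(y,z;u) := J(y,z;yu,z/u)`;
* §2 ★★ the imbalance `δ(s) = b(ye^s, ze^{−s}) − b(ze^{−s}, ye^s)` is STRICTLY INCREASING along the anti-ray with derivative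
  `(m₁₁ + 2m₁₂ + m₂₂)/D > 0` (susceptibility matrix);
* §3 ★★★★ **THE LDP OF THE IMBALANCE**: for `u > 1`, with `d = b(yu,z/u) − b(z/u,yu)`,
  `lim (1/N) log P_{N,y,z}((bc/N,tc/N) ∈ T, bc/N − tc/N > d) = −J(y,z; yu, z/u)` — the minimum of the extended rate over the closed half-triangle
  `{a − a' ≥ d}` sits at the anti-ray point (supporting plane with normal `(log u, −log u)`), and `…BoundaryLimit`'s limit theorem applies.

## Sources
DemboZeitouni2010 §4.2.1 (contraction principle) and §2.2 (Cramér; exponential tilts); JansevanRensburg2000 §3.2–§3.3 (1st ed., OUP 2000).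
Nothing quoted AS PRINTED; statements are this lineage's.
-/

noncomputable section

open Filter Topology Finset Literature.Probability.LatticeModels Literature.Probability.Percolation SimpleGraph

namespace Literature.Probability.RandomPlanarGeometry.SAW.HexBW

open WidthOneYZ Real

variable {y z : ℝ}

/-! ## §1 Anti-ray Pythagoras and the fibre minimum -/

/-- ★★★ **ANTI-RAY PYTHAGORAS**: for `y, z, u, Y, Z > 0` with `b(Y,Z) − b(Z,Y) = b(yu,z/u) − b(z/u,yu)` (same contact imbalance as the
anti-ray point), `J(y,z;Y,Z) = J(y,z; yu, z/u) + J(yu, z/u; Y,Z)`. [cite: DemboZeitouni2010, §4.2.1 Theorem 4.2.1 and §2.2 (lane statement)] -/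
theorem jointRate_eq_antiRay_add (hy : 0 < y) (hz : 0 < z) {u Y Z : ℝ} (hu : 0 < u) (hY : 0 < Y) (hZ : 0 < Z)
    (hfib : contactB Y Z - contactB Z Y = contactB (y * u) (z / u) - contactB (z / u) (y * u)) :
    jointRate y z Y Z = jointRate y z (y * u) (z / u) + jointRate (y * u) (z / u) Y Z := by
  have hyu : 0 < y * u := mul_pos hy hu
  have hzu : 0 < z / u := div_pos hz hu
  rw [jointRate_change_of_base hy hz hyu hzu hY hZ]
  have e1 : y * u / y = u := by field_simp
  have e2 : z / u / z = u⁻¹ := by field_simp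
  have hJ : jointRate y z (y * u) (z / u) =
      contactB (y * u) (z / u) * Real.log u + contactB (z / u) (y * u) * Real.log u⁻¹ -
        Real.log (stripMuY₂ 1 (y * u) (z / u) / stripMuY₂ 1 y z) := by
    unfold jointRate; rw [e1, e2]
  rw [hJ, e1, e2, Real.log_inv]
  have : contactB Y Z * Real.log u + contactB Z Y * -Real.log u = (contactB Y Z - contactB Z Y) * Real.log u := by ring
  rw [this, hfib]
  ring

/-- ★★★ **THE FIBRE MINIMUM OF THE JOINT RATE AT FIXED IMBALANCE IS THE ANTI-RAY POINT**: for `y, z, u > 0`, over all tilts `(Y,Z)` with the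
imbalance of `(yu, z/u)`, `J(y,z;·)` is least at `(yu, z/u)` (value `I_anti(y,z;u) = J(y,z;yu,z/u)`), strictly larger elsewhere.
[cite: DemboZeitouni2010, §4.2.1 Theorem 4.2.1 (contraction principle; lane statement)] -/
theorem isLeast_jointRate_antiFibre (hy : 0 < y) (hz : 0 < z) {u : ℝ} (hu : 0 < u) :
    IsLeast {r : ℝ | ∃ Y Z : ℝ, 0 < Y ∧ 0 < Z ∧
      contactB Y Z - contactB Z Y = contactB (y * u) (z / u) - contactB (z / u) (y * u) ∧ r = jointRate y z Y Z}
      (jointRate y z (y * u) (z / u)) ∧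
    ∀ Y Z : ℝ, 0 < Y → 0 < Z → contactB Y Z - contactB Z Y = contactB (y * u) (z / u) - contactB (z / u) (y * u) →
      (Y ≠ y * u ∨ Z ≠ z / u) → jointRate y z (y * u) (z / u) < jointRate y z Y Z := by
  have hyu : 0 < y * u := mul_pos hy hu
  have hzu : 0 < z / u := div_pos hz hu
  refine ⟨⟨⟨y * u, z / u, hyu, hzu, rfl, rfl⟩, ?_⟩, ?_⟩
  · rintro r ⟨Y, Z, hY, hZ, hfib, rfl⟩
    rw [jointRate_eq_antiRay_add hy hz hu hY hZ hfib]
    linarith [jointRate_nonneg_all hyu hzu hY hZ]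
  · intro Y Z hY hZ hfib hne
    rw [jointRate_eq_antiRay_add hy hz hu hY hZ hfib]
    have hne' : y * u ≠ Y ∨ z / u ≠ Z := by
      rcases hne with h | h
      · exact Or.inl (Ne.symm h)
      · exact Or.inr (Ne.symm h)
    linarith [jointRate_pos hyu hzu hY hZ hne']

/-! ## §2 The imbalance is strictly increasing along anti-rays -/

/-- ★★ **MONOTONICITY OF THE IMBALANCE ALONG ANTI-RAYS, WITH ITS RATE**: for all `A, B`, the imbalance
`s ↦ b(e^{A+s}, e^{B−s}) − b(e^{B−s}, e^{A+s})` has derivative `(m₁₁ + 2m₁₂ + m₂₂)/D > 0` at `s = 0` (entries of `M = −Hess s` at the typical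
pair of `(e^A,e^B)`; the susceptibility matrix `M⁻¹` applied to the direction `(1,−1)` and paired with `(1,−1)`).
[cite: DemboZeitouni2010, §2.2 (lane statement); JansevanRensburg2000, §3.3 (1st ed.)] -/
theorem hasDerivAt_imbalance_antiRay (A B : ℝ) :
    let b := contactB (Real.exp A) (Real.exp B)
    let b' := contactB (Real.exp B) (Real.exp A)
    let m₁₁ := 4 / (1 - 2 * b - 2 * b') + 8 / (4 * b + 2 * b' - 1) + 2 / (2 * b + 4 * b' - 1) - 1 / b
    let m₁₂ := 4 / (1 - 2 * b - 2 * b') + 4 / (4 * b + 2 * b' - 1) + 4 / (2 * b + 4 * b' - 1)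
    let m₂₂ := 4 / (1 - 2 * b - 2 * b') + 2 / (4 * b + 2 * b' - 1) + 8 / (2 * b + 4 * b' - 1) - 1 / b'
    HasDerivAt (fun s : ℝ => contactB (Real.exp (A + s)) (Real.exp (B - s)) - contactB (Real.exp (B - s)) (Real.exp (A + s)))
      ((m₁₁ + 2 * m₁₂ + m₂₂) / (m₁₁ * m₂₂ - m₁₂ ^ 2)) 0 ∧
    0 < (m₁₁ + 2 * m₁₂ + m₂₂) / (m₁₁ * m₂₂ - m₁₂ ^ 2) := by
  intro b b' m₁₁ m₁₂ m₂₂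
  obtain ⟨E, hE, hg⟩ := hasStrictFDerivAt_densityMap A B
  obtain ⟨hD, hm12, -, -, -, -, -⟩ := hasDerivAt_contactB_log A B
  obtain ⟨t1, t2, t3⟩ := contactB_mem_triangle (Real.exp_pos A) (Real.exp_pos B)
  obtain ⟨hm11, -⟩ := logTiltDeriv_det_pos t1 t2 t3
  set D := m₁₁ * m₂₂ - m₁₂ ^ 2 with hDdef
  have hD0 : D ≠ 0 := ne_of_gt hD
  have hm22 : 0 < m₂₂ := by
    have h := curvatureForm_pos t1 t2 t3 (v₁ := 0) (v₂ := 1) (by simp)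
    have e : 4 * ((0 : ℝ) + 1) ^ 2 / (1 - 2 * b - 2 * b') + 2 * (2 * 0 + 1) ^ 2 / (4 * b + 2 * b' - 1)
        + 2 * (0 + 2 * 1) ^ 2 / (2 * b + 4 * b' - 1) - 0 ^ 2 / b - 1 ^ 2 / b' = m₂₂ := by
      show _ = 4 / (1 - 2 * b - 2 * b') + 2 / (4 * b + 2 * b' - 1) + 8 / (2 * b + 4 * b' - 1) - 1 / b'; ring
    rw [e] at h; exact h
  -- `E⁻¹ (1,−1) = ((m₂₂ + m₁₂)/D, −(m₁₂ + m₁₁)/D)`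
  have hinv : E.symm (1, -1) = ((m₂₂ + m₁₂) / D, -(m₁₂ + m₁₁) / D) := by
    have h := hE ((m₂₂ + m₁₂) / D, -(m₁₂ + m₁₁) / D)
    have e : E ((m₂₂ + m₁₂) / D, -(m₁₂ + m₁₁) / D) = (1, -1) := by
      rw [h]
      refine Prod.ext ?_ ?_
      · show m₁₁ * ((m₂₂ + m₁₂) / D) + m₁₂ * (-(m₁₂ + m₁₁) / D) = 1
        field_simp; rw [hDdef]; ring
      · show m₁₂ * ((m₂₂ + m₁₂) / D) + m₂₂ * (-(m₁₂ + m₁₁) / D) = -1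
        field_simp; rw [hDdef]; ring
    rw [← e, ContinuousLinearEquiv.symm_apply_apply]
  have hline : HasDerivAt (fun s : ℝ => ((A + s, B - s) : ℝ × ℝ)) ((1, -1) : ℝ × ℝ) 0 := by
    have h1 : HasDerivAt (fun s : ℝ => A + s) 1 0 := by simpa using (hasDerivAt_id (0 : ℝ)).const_add A
    have h2 : HasDerivAt (fun s : ℝ => B - s) (-1) 0 := by simpa using (hasDerivAt_id (0 : ℝ)).const_sub B
    exact h1.prodMk h2
  have hg0 : HasFDerivAt (fun q : ℝ × ℝ => ((contactB (Real.exp q.1) (Real.exp q.2), contactB (Real.exp q.2) (Real.exp q.1)) : ℝ × ℝ))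
      (E.symm : (ℝ × ℝ) →L[ℝ] (ℝ × ℝ)) ((A + 0, B - 0) : ℝ × ℝ) := by
    simp only [add_zero, sub_zero]; exact hg.hasFDerivAt
  have hcomp := hg0.comp_hasDerivAt (0 : ℝ) hline
  rw [ContinuousLinearEquiv.coe_coe, hinv] at hcomp
  have d1 := (hasFDerivAt_fst (𝕜 := ℝ) (E := ℝ) (F := ℝ)).comp_hasDerivAt 0 hcomp
  have d2 := (hasFDerivAt_snd (𝕜 := ℝ) (E := ℝ) (F := ℝ)).comp_hasDerivAt 0 hcomp
  have d := d1.sub d2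
  simp only [Function.comp_def] at d
  refine ⟨d.congr_deriv ?_, ?_⟩
  · show (m₂₂ + m₁₂) / D - -(m₁₂ + m₁₁) / D = (m₁₁ + 2 * m₁₂ + m₂₂) / D
    field_simp; ring
  · positivity

/-! ## §3 The LDP of the imbalance -/

open Classical in
/-- ★★★★ **THE LARGE DEVIATIONS OF THE CONTACT IMBALANCE**: for `y, z > 0` and `u > 1`, with `d = b(yu,z/u) − b(z/u,yu)` the imbalance typical
under the anti-ray tilt,
`lim_{N→∞} (1/N) log P_{N,y,z}((bc/N, tc/N) ∈ T, bc/N − tc/N > d) = −J(y,z; yu, z/u)` —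
the minimum of the extended rate over the closed half-triangle `{a − a' ≥ d} ∩ T̄` is attained at the anti-ray density pair (supporting plane
with normal `(log u, −log u)`, `log u > 0`), and `ldp_limit_open_closed` gives the limit.
[cite: DemboZeitouni2010, §4.2.1 Theorem 4.2.1 (contraction principle) and §2.2 Theorem 2.2.30; JansevanRensburg2000, §3.2 (1st ed.; lane statement)] -/
theorem ldp_imbalance_gt (hy : 0 < y) (hz : 0 < z) {u : ℝ} (hu : 1 < u) :
    Tendsto (fun N : ℕ => Real.log ((∑ q ∈ (stripPairs 1 N).filter (fun q =>
        (((bottomVisits₀ q.1 q.2 N : ℝ) / N, (topVisits₀ 1 q.1 q.2 N : ℝ) / N) : ℝ × ℝ) ∈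
          {p : ℝ × ℝ | p.1 + p.2 < 1 / 2 ∧ 1 < 4 * p.1 + 2 * p.2 ∧ 1 < 2 * p.1 + 4 * p.2} ∩
            {p : ℝ × ℝ | contactB (y * u) (z / u) - contactB (z / u) (y * u) < p.1 - p.2}), wgt y z N q) / stripZ₂ 1 N y z) / N)
      atTop (𝓝 (-(jointRate y z (y * u) (z / u)))) := by
  have hu0 : 0 < u := by linarith
  have hyu : 0 < y * u := mul_pos hy hu0
  have hzu : 0 < z / u := div_pos hz hu0
  obtain ⟨k1, k2, k3⟩ := contactB_mem_triangle hyu hzu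
  set a₀ := contactB (y * u) (z / u) with ha₀
  set a₀' := contactB (z / u) (y * u) with ha₀'
  set d := a₀ - a₀' with hd
  -- the event set is open, bounded, nonempty, with closure in `T̄`
  have hGo : IsOpen ({p : ℝ × ℝ | p.1 + p.2 < 1 / 2 ∧ 1 < 4 * p.1 + 2 * p.2 ∧ 1 < 2 * p.1 + 4 * p.2} ∩ {p : ℝ × ℝ | d < p.1 - p.2}) := by
    refine isOpen_densityTriangle.inter ?_
    exact isOpen_lt continuous_const (continuous_fst.sub continuous_snd)
  have hGne : Set.Nonempty ({p : ℝ × ℝ | p.1 + p.2 < 1 / 2 ∧ 1 < 4 * p.1 + 2 * p.2 ∧ 1 < 2 * p.1 + 4 * p.2} ∩ {p : ℝ × ℝ | d < p.1 - p.2}) := by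
    obtain ⟨r, hr0, hball, -⟩ := exists_closedBall_jointRate_gt hy hz (x := (a₀, a₀')) ⟨k1, k2, k3⟩ one_pos
    refine ⟨(a₀ + r / 2, a₀' - r / 2), hball ?_, ?_⟩
    · rw [Metric.mem_closedBall, Prod.dist_eq, Real.dist_eq, Real.dist_eq]
      simp only [add_sub_cancel_left, sub_sub_cancel_left, abs_neg, abs_of_pos (half_pos hr0)]
      exact max_le (by linarith) (by linarith)
    · show d < a₀ + r / 2 - (a₀' - r / 2)
      rw [hd]; linarith
  have hGbd : Bornology.IsBounded ({p : ℝ × ℝ | p.1 + p.2 < 1 / 2 ∧ 1 < 4 * p.1 + 2 * p.2 ∧ 1 < 2 * p.1 + 4 * p.2} ∩ {p : ℝ × ℝ | d < p.1 - p.2}) := by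
    refine (Metric.isBounded_closedBall (x := ((0 : ℝ), (0 : ℝ))) (r := 1)).subset ?_
    rintro p ⟨⟨p1, p2, p3⟩, -⟩
    rw [Metric.mem_closedBall, Prod.dist_eq, Real.dist_eq, Real.dist_eq, sub_zero, sub_zero]
    refine max_le ?_ ?_ <;> rw [abs_le] <;> constructor <;> linarith
  have hGT : closure ({p : ℝ × ℝ | p.1 + p.2 < 1 / 2 ∧ 1 < 4 * p.1 + 2 * p.2 ∧ 1 < 2 * p.1 + 4 * p.2} ∩ {p : ℝ × ℝ | d < p.1 - p.2}) ⊆ {p : ℝ × ℝ | p.1 + p.2 ≤ 1 / 2 ∧ 1 ≤ 4 * p.1 + 2 * p.2 ∧ 1 ≤ 2 * p.1 + 4 * p.2} := by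
    have hcl : IsClosed {p : ℝ × ℝ | p.1 + p.2 ≤ 1 / 2 ∧ 1 ≤ 4 * p.1 + 2 * p.2 ∧ 1 ≤ 2 * p.1 + 4 * p.2} := by
      have c1 : IsClosed {p : ℝ × ℝ | p.1 + p.2 ≤ 1 / 2} := isClosed_le (continuous_fst.add continuous_snd) continuous_const
      have c2 : IsClosed {p : ℝ × ℝ | 1 ≤ 4 * p.1 + 2 * p.2} :=
        isClosed_le continuous_const ((continuous_const.mul continuous_fst).add (continuous_const.mul continuous_snd))
      have c3 : IsClosed {p : ℝ × ℝ | 1 ≤ 2 * p.1 + 4 * p.2} :=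
        isClosed_le continuous_const ((continuous_const.mul continuous_fst).add (continuous_const.mul continuous_snd))
      have e : {p : ℝ × ℝ | p.1 + p.2 ≤ 1 / 2 ∧ 1 ≤ 4 * p.1 + 2 * p.2 ∧ 1 ≤ 2 * p.1 + 4 * p.2} =
          {p : ℝ × ℝ | p.1 + p.2 ≤ 1 / 2} ∩ ({p : ℝ × ℝ | 1 ≤ 4 * p.1 + 2 * p.2} ∩ {p : ℝ × ℝ | 1 ≤ 2 * p.1 + 4 * p.2}) := by
        ext p; simp only [Set.mem_setOf_eq, Set.mem_inter_iff]
      rw [e]; exact c1.inter (c2.inter c3)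
    refine closure_minimal ?_ hcl
    rintro p ⟨⟨p1, p2, p3⟩, -⟩
    exact ⟨p1.le, p2.le, p3.le⟩
  obtain ⟨m, hm, hmin, hlim⟩ := ldp_limit_open_closed hy hz hGo hGne hGbd hGT
  -- the closure lies in the closed half-plane `{a − a' ≥ d}`
  have hmd : d ≤ m.1 - m.2 := by
    have hcl2 : closure ({p : ℝ × ℝ | p.1 + p.2 < 1 / 2 ∧ 1 < 4 * p.1 + 2 * p.2 ∧ 1 < 2 * p.1 + 4 * p.2} ∩ {p : ℝ × ℝ | d < p.1 - p.2}) ⊆ {p : ℝ × ℝ | d ≤ p.1 - p.2} := by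
      refine closure_minimal (fun p hp => ?_) ?_
      · have h2 : d < p.1 - p.2 := hp.2
        show d ≤ p.1 - p.2
        exact h2.le
      · exact isClosed_le continuous_const (continuous_fst.sub continuous_snd)
    exact hcl2 hm
  obtain ⟨t1, t2, t3⟩ := hGT hm
  -- the supporting plane at the anti-ray pair has normal `(log u, −log u)`
  obtain ⟨eY, eZ⟩ := eosY_contactB hyu hzu
  have hsup := tilt_inner_le_rateExt_sub hy hz k1 k2 k3 t1 t2 t3
  rw [eY, eZ, mul_div_cancel_left₀ _ hy.ne',
    show z / u / z = u⁻¹ by field_simp, Real.log_inv] at hsup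
  have hlogu : 0 < Real.log u := Real.log_pos hu
  have hge : jointRate y z (y * u) (z / u) ≤ Real.log (stripMuY₂ 1 y z) - m.1 * Real.log y - m.2 * Real.log z -
      (negMulLog (1 - 2 * m.1 - 2 * m.2) +
        (negMulLog (4 * m.1 + 2 * m.2 - 1) + negMulLog (2 * m.1 + 4 * m.2 - 1) - negMulLog (2 * m.1) - negMulLog (2 * m.2)) / 2) := by
    have : jointRate y z (y * u) (z / u) + Real.log u * (m.1 - a₀) + -Real.log u * (m.2 - a₀') =
        jointRate y z (y * u) (z / u) + Real.log u * ((m.1 - m.2) - d) := by rw [hd]; ring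
    rw [this] at hsup
    nlinarith [hsup, mul_nonneg hlogu.le (sub_nonneg.2 hmd)]
  -- the anti-ray pair is in the closure of the event set
  have hmem : ((a₀, a₀') : ℝ × ℝ) ∈ closure ({p : ℝ × ℝ | p.1 + p.2 < 1 / 2 ∧ 1 < 4 * p.1 + 2 * p.2 ∧ 1 < 2 * p.1 + 4 * p.2} ∩ {p : ℝ × ℝ | d < p.1 - p.2}) := by
    rw [Metric.mem_closure_iff]
    intro ε hε
    obtain ⟨r, hr0, hball, -⟩ := exists_closedBall_jointRate_gt hy hz (x := (a₀, a₀')) ⟨k1, k2, k3⟩ one_pos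
    set τ := min (r / 2) (ε / 2) with hτ
    have hτ0 : 0 < τ := lt_min (by linarith) (by linarith)
    have hτr : τ ≤ r / 2 := min_le_left _ _
    have hτε : τ ≤ ε / 2 := min_le_right _ _
    refine ⟨(a₀ + τ, a₀' - τ), ⟨hball ?_, ?_⟩, ?_⟩
    · rw [Metric.mem_closedBall, Prod.dist_eq, Real.dist_eq, Real.dist_eq]
      simp only [add_sub_cancel_left, sub_sub_cancel_left, abs_neg, abs_of_pos hτ0]
      exact max_le (by linarith) (by linarith)
    · show d < a₀ + τ - (a₀' - τ)
      rw [hd]; linarith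
    · rw [Prod.dist_eq, Real.dist_eq, Real.dist_eq]
      simp only [sub_add_cancel_left, abs_neg, sub_sub_cancel, abs_of_pos hτ0]
      exact max_lt (by linarith) (by linarith)
  have hle := (isMinOn_iff.1 hmin) _ hmem
  simp only at hle
  rw [← jointRate_eosY_eq_ext hy hz k1 k2 k3, eY, eZ] at hle
  have heq : Real.log (stripMuY₂ 1 y z) - m.1 * Real.log y - m.2 * Real.log z -
      (negMulLog (1 - 2 * m.1 - 2 * m.2) +
        (negMulLog (4 * m.1 + 2 * m.2 - 1) + negMulLog (2 * m.1 + 4 * m.2 - 1) - negMulLog (2 * m.1) - negMulLog (2 * m.2)) / 2) =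
      jointRate y z (y * u) (z / u) := le_antisymm hle hge
  rw [heq] at hlim
  convert hlim using 7

end Literature.Probability.RandomPlanarGeometry.SAW.HexBW
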